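import Mathlib
import Literature.Geometry.Riemannian.SphericalCylinderEntropy
import Literature.Geometry.Manifold.CylinderSlice
import Literature.Geometry.Riemannian.LowEntropyHypersurfacesFour
import Literature.Geometry.Riemannian.MeanConvexLevelSetFlow
import Literature.Geometry.Riemannian.HamiltonSurgeryProgramme
import Literature.Topology.FourManifolds.HomotopyS4CompactProofs
import Literature.AlgebraicTopology.FundamentalGroup.SphereSimplyConnected
import Summits.SmoothPoincare4.SmoothPoincare4.Theses.CylinderEntropy
import HarnessLib
import HarnessLib.Audit

/-!
# Line `proxy-models-below-bubble-sheet` — skeleton for crux `CylinderEntropy.CylinderRungTwo`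
# (item stmt-SmoothPoincare4-7631), crux-plan of idea card `Ideas/proxy-models-below-bubble-sheet.md`

crux-plan round 1, generation 2 · planner-cruxplan-stmt-SmoothPoincare4-7631-proxy-models-below-b-g2-0 · 2026-08-16 ·
triage r1: pass ×3. Supersedes the generation-1 file at the same path (same six-stub cut; re-encoded to the
D-0027 §3.2(3) shape `CylinderRungTwo_of : stub₁ → … → stub₆ → CylinderRungTwo` with a sorry-free cone, the
Chodosh–Mantoulidis–Schulze fact referenced BY NAME instead of restated, statements named, docstrings re-sourced
on the page; see `Lines/proxy-models-below-bubble-sheet.md`).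

**Crux (by name, never restated):** `Summit.SmoothPoincare4.SmoothPoincare4.Theses.CylinderEntropy.CylinderRungTwo`
— a homotopy 4-sphere `M` smoothly embedded in `N = S⁴ × ℝ ⊂ ℝ⁶` as an end-separating cross-section with typed
cylinder entropy `λ_cyl(range ι) < ofReal (4/e)` is diffeomorphic to `S⁴`.

## The line (card + triage)

Apply the Euclidean low-entropy theorem to the BLOW-UP MODEL, never to `M`. Strictly below `λ(S²×ℝ²) = 4/e`
the singularity models of a mean curvature flow in `N` (Hamilton's monotonicity in `N` bounds the Gaussian
entropy of every model by `λ_cyl(M₀)`) are: hyperplanes (regular points), round `S⁴`, necks `S³×ℝ`, compact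
smooth shrinkers `Σ` — the TAME models — and the non-tame rest (non-compact non-generic models, compact SINGULAR
models, i.e. cones over minimal `Σ³ ⊂ S⁴`, triage r1-2). Two levers: (i) PROXY — a compact smooth model
`Σ ⊂ T_xN ≅ ℝ⁵` captures a whole dying component `C ≅ Σ`, and `Σ` is a closed simply connected embedded
hypersurface of `ℝ⁵` with `λ(Σ) < 4/e`, so the tree fact
`Literature.Geometry.Riemannian.ChodoshMantoulidisSchulze2025_lowEntropy_sphere_four` (b) gives `Σ ≅ S⁴`: compact
smooth models never need perturbing; (ii) NO ACCUMULATION — tame points are relatively open in the spacetime track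
(Huisken for `S⁴`; Bernstein–Wang + Choi–Haslhofer–Hershkovits(–White) Thm 1.17 for necks, "in arbitrary ambient
manifolds"; compact smooth models are isolated deaths), which is verbatim the dichotomy CMS II say is "only known"
at `Sⁿ(√2n)` and `Sⁿ⁻¹×ℝ` limits (arXiv:2309.03856 §1.2, p. 4, read) — below `4/e` that is EVERY generic limit, so
§6 of CMS II ("non-generic singularities limiting to bubble-sheet generic singularities", §1.7) is moot and the
generic-perturbation debt is their Thm 1.13 for `n = 4` (hypotheses `(◇)` vacuous for `n ≤ 6`, Rem 1.16, `(♡)`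
vacuous for `n ≤ 4`, Rem 1.17(a)) proved by §§2–5 only (smoothly crossing flows and parabolic covering, low-entropy
`F`-stationary varifolds, one-sided nearly ancient flows, density drop), ported to `N` with Hamilton's kernel
density, against the CLOSED set of non-tame points.

## How it is typed (local objects = definition requests; everything else is tree vocabulary)

* The ambient: a PRESENTATION `(Ncar, gN, emb)` of `N` — an abstract 5-manifold on `ℝ⁵` with a tree
  `PseudoRiemannianMetric gN` and a smooth embedding `emb : Ncar → ℝ⁶` onto `cylN = {∑_{i<5} zᵢ² = 1}` pulling the
  Euclidean metric back to `gN` (`IsCylinderPresentation`). This is what lets the line use the tree's weak-flow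
  vocabulary `Literature.Geometry.Riemannian.levelSetFlow gN K₀ t` (White's biggest flow; `MeanConvexLevelSetFlow.lean`)
  for the flow in `N` of the cross-section `K₀ = emb ⁻¹' range κ`. (A presentation exists: `ℝ⁵ ∖ {0}` with
  `emb y = (y/‖y‖, log ‖y‖)` and the induced metric, tree `PseudoRiemannianMetric.inducedMetric` as in
  `RoundSphere.roundMetric`, `HasLeviCivita` by tree `PseudoRiemannianMetric.hasLeviCivita`; it is produced inside
  the port stub and consumed by the others universally.)
* The flow downstairs: its spacetime TRACK `flowTrack gN emb K₀ ⊆ ℝ⁶ × ℝ`; set-level BLOW-UP MODELS at `(x₀, t₀)`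
  (`IsBlowUpModel`: parabolic dilations of the track converge, locally in Hausdorff sense on the windows
  `B̄_R × [-R, -1/R]`, along some sequence of scales `→ ∞`, to the self-shrinking track `{(√(-t)·y, t)}` of a CLOSED
  set `Mdl ⊆ T_{x₀}N`); TAME models (`IsTameModel`: `A''(hyperplane)`, `A''(S³(√6) × ℝ)` = `shrinkingCylinder 4 3`, or
  `A''(range j)` for a smooth embedding `j : S → ℝ⁵` of a CLOSED CONNECTED smooth 4-manifold `S`, where
  `A : ℝ⁵ →ₗᵢ ℝ⁶` is a linear isometry onto `T_{x₀}N`); `IsTamePoint`, `IsTame`, `HasThinTrack`. Multiplicity is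
  invisible at set level and is not needed: every entropy in the line is `< 4/e < 2`.
* The topological output: the inductive `IsProxyResolvable T P` — the tree's `IsNeckSurgeryResolvable`
  (`HamiltonSurgeryProgramme.lean`: separating neck surgeries with `Literature.Topology.FourManifolds.NeckCapData` sides) with its
  model pieces replaced by the two leaf classes of THIS line: `P ≅ S⁴`, or `P ≅ S` for the domain `S` of a compact
  smooth blow-up model `A''(range j)` of the track `T` at some `(x₀, t₀)`, `t₀ > 0` (entropy NOT recorded in the
  leaf: it is supplied by Hamilton's bound in the glue, so that both levers stay load-bearing).

## Stubs (6, registered as `Holds.stub_<name>`; by-name handles `stub_<name>`) and composition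

    CylinderRungTwo ⇐ stub_tameIsOpen              `TameIsOpen` — lever (ii): tame points are relatively open in the
                                                   track of the flow of a thin closed hypersurface of N. M–L.
                    → stub_densityDropPort          `TameIsOpen → DensityDropPort` — HARDEST / open: CMS II Thm 1.13
                                                   (§§2–5) in N: every closed connected P with a thin separating
                                                   cross-section has one whose level set flow in N is TAME.
                    → stub_hamiltonEntropyBound     `HamiltonEntropyBound` — Hamilton 1993 monotonicity + kernel
                                                   asymptotics + CM12 + Stone: compact smooth blow-up models of thin
                                                   flows have gaussianEntropy < gaussianEntropy (S²(2)×ℝ²). L.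
                    → stub_relaxationToSlice        `RelaxationToSlice` — immortal half (shared with ground-state-
                                                   relaxation / killing-flux): tame + thin + separating + connected
                                                   ⇒ eventually the flow IS a smoothly embedded S⁴. L/XL.
                    → stub_tameSurgeryStructure     `TameSurgeryStructure` — finite half (Daniels–Holgate in N,
                                                   topological shadow) + proxy capture ⇒ IsProxyResolvable. L/XL.
                    → stub_cmsLowEntropySphereFour  the tree NAMED FACT `ChodoshMantoulidisSchulze2025_lowEntropy_
                                                   sphere_four` BY NAME (CMS Duke 2025 Cor 1.5, n = 4): citation stub,
                                                   closes as "closed modulo ⟨that fact⟩"; do not staff.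
                    → CylinderRungTwo               `CylinderRungTwo_of` (sorry-free cone, closed = true).

`CylinderRungTwo_of h₁ … h₆`: `M ≃ₕ S⁴` ⇒ compact, connected, simply connected (tree); port (fed with openness)
⇒ presentation + thin tame separating cross-section `κ` of `M`; relaxation ⇒ `T₀` and an embedded `S⁴` equal to the
time-`T₀` flow; structure ⇒ `IsProxyResolvable`; the glue `IsProxyResolvable.neckSurgeryResolvable` (induction over the
surgery tree, sorry-free: Hamilton's bound + CMS (b) on the model leaves, `π₁ = 1` threaded through
`NeckCapData.isConnectedSum_capped` / `IsConnectedSum.simplyConnectedSpace_left|right`) ⇒ tree `IsNeckSurgeryResolvable M`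
⇒ tree `IsNeckSurgeryResolvable.nonempty_diffeomorph_sphere` ⇒ `M ≃ₘ S⁴`. The crux proof modulo the stubs is the
`example` after it (kept an `example` so that `CylinderRungTwo_of` is the unique theorem concluding the crux).

## Disproof / negatives honoured

`Disproof.lean` of refuter-cdisprove-stmt-SmoothPoincare4-7631-0 (cycle-1 close, 115 decls; the `run/gate/evidence` body
is not mounted in planner jails — read through its seven evidence notes): the sandwich `cylinderRungTwo_of_spc4` /
`exotic_of_not_rung` (no stub restates the crux or SPC4: the stubs conclude openness of a set, existence of a tame flow
for ANY closed connected `P`, an entropy inequality between two subsets of `ℝ⁵`, existence of embedded-`S⁴` time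
slices for ANY closed connected `P`, resolvability with UNRESOLVED model leaves, and a printed theorem about
hypersurfaces of `ℝ⁵`); `rungWithoutHomotopyEntropy_false` / `two_le_cylEntropy_twoSlices` (witness `S⁴ ⊔ S⁴` =
`CylinderSlice.twoSlices`): the entropy hypothesis is consumed by stubs 2–5 and CONNECTEDNESS (from `M ≃ₕ S⁴`) by stubs
2 and 4 — `RelaxationToSlice` is false for two slices without `ConnectedSpace P`, and carries it; "only `M ≃ₕ S⁴` is
load-bearing" (`rungWithout{Separation,Entropy,Embedding}_of_spc4`): it is used exactly as compactness (all stubs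
quantify over CLOSED `P`), connectedness (stubs 2/4) and simple connectivity (stub 5, the glue, the CMS leaf, the final
tree theorem); the near-miss `rungWithoutHomotopy_false` (slice ⊔ small far sphere, `λ_cyl → 1.4436`) is a ROUND
compact death + the slice root here, consistent. `ledger negatives --problem SmoothPoincare4` = 0; no
`Theorems/CylinderRungTwo/Negative/` lemma has landed (nothing to import or to check stubs against).
-/

noncomputable section

set_option linter.dupNamespace false

open scoped BigOperators Manifold ContDiff ENNReal Topology
open Set Filter MeasureTheory
open Literature.Geometry.Riemannian Literature.Geometry.Riemannian.SphericalCylinderEntropy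
open Literature.Geometry.Lorentzian Literature.Topology.FourManifolds

namespace Summit.SmoothPoincare4.SmoothPoincare4.Cruxes.CylinderRungTwo.ProxyModelsBelowBubbleSheet

local notation "E4" => EuclideanSpace ℝ (Fin 4)
local notation "E5" => EuclideanSpace ℝ (Fin 5)
local notation "E6" => EuclideanSpace ℝ (Fin 6)
local notation "𝕊⁴" => (Metric.sphere (0 : EuclideanSpace ℝ (Fin 5)) 1)
local notation "𝕊³" => (Metric.sphere (0 : EuclideanSpace ℝ (Fin 4)) 1)

attribute [local instance] Literature.Topology.FourManifolds.fact_finrank_euclideanSpace_succ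

/-! ## Objects of the line (definition requests; concrete, in the coordinates of the route items) -/

/-- The round cylinder `N = S⁴ × ℝ ⊂ ℝ⁶`, spelled exactly as in the route items. -/
def cylN : Set E6 := {z | ∑ i : Fin 5, z (Fin.castSucc i) ^ 2 = 1}

/-- `A ⊆ ℝ⁶` separates the two ends of `N` — the typed `JoinedIn` predicate of the route items, verbatim (so that the
crux hypothesis IS `SeparatesEnds (Set.range ι)` by `rfl`). -/
def SeparatesEnds (A : Set E6) : Prop :=
  ∃ R : ℝ, ∀ a b : EuclideanSpace ℝ (Fin 6), ∑ i : Fin 5, a (Fin.castSucc i) ^ 2 = 1 →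
    ∑ i : Fin 5, b (Fin.castSucc i) ^ 2 = 1 → a 5 ≤ -R → R ≤ b 5 →
      ¬ JoinedIn ({z : EuclideanSpace ℝ (Fin 6) | ∑ i : Fin 5, z (Fin.castSucc i) ^ 2 = 1} \ A) a b

section Presentation

variable {Ncar : Type} [TopologicalSpace Ncar] [ChartedSpace (EuclideanSpace ℝ (Fin 5)) Ncar]
  [IsManifold (𝓡 5) ∞ Ncar]

/-- **Presentation of the round cylinder.** `(Ncar, gN, emb)` presents `N = S⁴ × ℝ` as an abstract Riemannian
5-manifold: `emb : Ncar → ℝ⁶` is a smooth embedding with range exactly `cylN`, and the tree metric `gN`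
(`Literature.Geometry.Lorentzian.PseudoRiemannianMetric`) is the pull-back of the Euclidean inner product
(`g(v,v) = ‖d emb v‖²`; polarisation gives the bilinear identity). Any two presentations are isometric; the
analytic statements quantify over all of them and the port produces one (`ℝ⁵ ∖ {0}`, `y ↦ (y/‖y‖, log ‖y‖)`,
induced metric — cf. tree `RoundSphere.roundMetric`). -/
def IsCylinderPresentation
    (gN : PseudoRiemannianMetric (𝓡 5) ∞ (EuclideanSpace ℝ (Fin 5)) (TangentSpace (𝓡 5) : Ncar → Type _))
    (emb : Ncar → E6) : Prop :=
  Manifold.IsSmoothEmbedding (𝓡 5) (𝓡 6) ∞ emb ∧ Set.range emb = cylN ∧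
    ∀ (x : Ncar) (v : TangentSpace (𝓡 5) x),
      gN.val x v v = ‖(@id (EuclideanSpace ℝ (Fin 6)) (mfderiv (𝓡 5) (𝓡 6) emb x v))‖ ^ 2

/-- **The spacetime track, downstairs in `ℝ⁶ × ℝ`, of the level set flow in `N` of `K₀ ⊆ Ncar`**:
`{(emb x, t) | x ∈ F_t(K₀)}` with `F_t = Literature.Geometry.Riemannian.levelSetFlow gN K₀ t` (White's biggest weak
set flow; empty for `t < 0`). For `K₀ = emb ⁻¹' range κ`, `κ` a smooth closed hypersurface of `N`, this is the
mean curvature flow of `κ` in `N` continued through singularities. -/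
def flowTrack (gN : PseudoRiemannianMetric (𝓡 5) ∞ (EuclideanSpace ℝ (Fin 5)) (TangentSpace (𝓡 5) : Ncar → Type _))
    [gN.HasLeviCivita] (emb : Ncar → E6) (K₀ : Set Ncar) : Set (E6 × ℝ) :=
  {q | ∃ x : Ncar, x ∈ levelSetFlow gN K₀ q.2 ∧ emb x = q.1}

end Presentation

/-! ### Set-level blow-ups -/

/-- Parabolic dilation of spacetime about `(x₀, t₀)` by the factor `lam`: `(z, t) ↦ (lam (z - x₀), lam² (t - t₀))`. -/
def dilate (x₀ : E6) (t₀ lam : ℝ) (q : E6 × ℝ) : E6 × ℝ :=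
  (lam • (q.1 - x₀), lam ^ 2 * (q.2 - t₀))

/-- The self-shrinking (backward) track `{(√(-t) · y, t) | y ∈ Mdl, t < 0}` of a set `Mdl ⊆ ℝ⁶` (the time `-1`
slice of a shrinker, or a cone such as a hyperplane). -/
def shrinkerTrack (Mdl : Set E6) : Set (E6 × ℝ) :=
  {q | q.2 < 0 ∧ ∃ y ∈ Mdl, q.1 = Real.sqrt (-q.2) • y}

/-- The parabolic window `B̄_R(0) × [-R, -1/R]` (compact, strictly before the blow-up time). -/
def window (R : ℝ) : Set (E6 × ℝ) :=
  Metric.closedBall (0 : E6) R ×ˢ Set.Icc (-R) (-R⁻¹)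

/-- **`Mdl` is a (set-level, backward) blow-up model of the track `T` at `(x₀, t₀)`**: `Mdl` is CLOSED (so that it is
determined by the limit track) and along some sequence of scales `Λ k → ∞` the dilated tracks converge to
`shrinkerTrack Mdl` in the local Hausdorff sense — on every window, each lies in the `ε`-thickening of the other,
eventually. For the support of a unit-regular integral Brakke flow these are exactly the supports of its tangent
flows at `(x₀, t₀)` restricted to negative times (clearing-out + upper semicontinuity of density make support
convergence Hausdorff); multiplicities are forgotten (every density in the line is `< 4/e < 2`). Off the (closed) track
the only model is `Mdl = ∅`; at an interior point of a FAT track the only model is `Mdl = T_{x₀}N` — neither is tame. -/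
def IsBlowUpModel (T : Set (E6 × ℝ)) (x₀ : E6) (t₀ : ℝ) (Mdl : Set E6) : Prop :=
  IsClosed Mdl ∧ ∃ Λ : ℕ → ℝ, Tendsto Λ atTop atTop ∧
    ∀ R ε : ℝ, 0 < R → 0 < ε → ∀ᶠ k in atTop,
      dilate x₀ t₀ (Λ k) '' T ∩ window R ⊆ Metric.thickening ε (shrinkerTrack Mdl) ∧
        shrinkerTrack Mdl ∩ window R ⊆ Metric.thickening ε (dilate x₀ t₀ (Λ k) '' T)

/-- **Tame models at `x₀ ∈ N`.** `Mdl ⊆ T_{x₀}N` is one of: a hyperplane through `0`; the round shrinking neck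
`S³(√6) × ℝ` (`shrinkingCylinder 4 3`); or the image of a smooth embedding `j : S → ℝ⁵` of a CLOSED CONNECTED smooth
4-manifold `S` (compact smooth models — the round shrinking `S⁴(√8)` included) — each placed in `T_{x₀}N ⊂ ℝ⁶` by a
linear isometry `A : ℝ⁵ → ℝ⁶` with range orthogonal to the normal `(x₀', 0)` of `N` at `x₀`. Below entropy `4/e`
these are all the GENERIC-or-COMPACT-SMOOTH models; the non-tame rest (non-compact non-generic, compact singular) is
what the port must perturb away. -/
def IsTameModel (x₀ : E6) (Mdl : Set E6) : Prop :=
  ∃ A : E5 →ₗᵢ[ℝ] E6, (∀ v : E5, ∑ i : Fin 5, (A v) (Fin.castSucc i) * x₀ (Fin.castSucc i) = 0) ∧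
    (Mdl = (⇑A) '' {y : E5 | y 0 = 0} ∨ Mdl = (⇑A) '' shrinkingCylinder 4 3 ∨
      ∃ (S : Type) (_ : TopologicalSpace S) (_ : T2Space S) (_ : SecondCountableTopology S)
        (_ : CompactSpace S) (_ : ConnectedSpace S) (_ : ChartedSpace (EuclideanSpace ℝ (Fin 4)) S)
        (_ : IsManifold (𝓡 4) ∞ S) (j : S → E5),
        Manifold.IsSmoothEmbedding (𝓡 4) (𝓡 5) ∞ j ∧ Mdl = (⇑A) '' Set.range j)

/-- `(x₀, t₀)` is a **tame point** of the track `T`: every blow-up model there is tame. (Regular points are tame: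
their models are hyperplanes.) -/
def IsTamePoint (T : Set (E6 × ℝ)) (x₀ : E6) (t₀ : ℝ) : Prop :=
  ∀ Mdl : Set E6, IsBlowUpModel T x₀ t₀ Mdl → IsTameModel x₀ Mdl

/-- The track `T` is **tame**: every point of `T` at positive time is tame. (A tame track is automatically
non-fattening: interior points of a fat track are not tame.) -/
def IsTame (T : Set (E6 × ℝ)) : Prop :=
  ∀ (x₀ : E6) (t₀ : ℝ), 0 < t₀ → (x₀, t₀) ∈ T → IsTamePoint T x₀ t₀

/-- The track `T` is **thin** (the level set flow does not fatten): `T` has empty interior relative to `cylN × ℝ`,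
i.e. every point of `T` is a limit of points of `N × ℝ` off `T`. Fattening levels of a foliation are at most
countable (Evans–Spruck / Ilmanen), so genericity arguments lose nothing by restricting to thin tracks. -/
def HasThinTrack (T : Set (E6 × ℝ)) : Prop :=
  ∀ q ∈ T, q ∈ closure ((cylN ×ˢ (Set.univ : Set ℝ)) \ T)

/-! ### The topological output: resolvability with model leaves -/

/-- **Resolvability by separating neck surgeries into spheres and compact smooth blow-up models of `T`.** The
tree's `Literature.Geometry.Riemannian.IsNeckSurgeryResolvable` (Hamilton's surgery programme, topological shadow)
with its model pieces replaced by the leaves of THIS line: (`sphere`) `P ≅ S⁴`; (`model`) `P ≅ S` where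
`j : S → ℝ⁵` embeds the closed connected 4-manifold `S` as a compact smooth blow-up model `A''(range j)` of the track
`T` at some `(x₀, t₀)`, `t₀ > 0` (PROVENANCE is recorded, entropy is not); (`of_diffeomorph`) invariance;
(`surgery`) along a neck `ψ : S³ × ℝ ↪ P` whose middle sphere separates `P` into the sides `D₁`, `D₂`
(`Literature.Topology.FourManifolds.NeckCapData`), from resolvability of the two capped sides `Dᵢ.Capped`. -/
inductive IsProxyResolvable (T : Set (E6 × ℝ)) :
    ∀ (P : Type) [TopologicalSpace P] [ChartedSpace (EuclideanSpace ℝ (Fin 4)) P], Prop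
  /-- A piece diffeomorphic to `S⁴` is resolved (the root after relaxation; round points; 2-convex tubes). -/
  | sphere {P : Type} [TopologicalSpace P] [ChartedSpace (EuclideanSpace ℝ (Fin 4)) P]
      (e : P ≃ₘ⟮𝓡 4, 𝓡 4⟯ 𝕊⁴) : IsProxyResolvable T P
  /-- A piece diffeomorphic to the domain of a compact smooth blow-up model of `T` is resolved (a compact death). -/
  | model {P : Type} [TopologicalSpace P] [ChartedSpace (EuclideanSpace ℝ (Fin 4)) P]
      (x₀ : E6) (t₀ : ℝ) (ht₀ : 0 < t₀) (A : E5 →ₗᵢ[ℝ] E6)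
      (hA : ∀ v : E5, ∑ i : Fin 5, (A v) (Fin.castSucc i) * x₀ (Fin.castSucc i) = 0)
      (S : Type) [TopologicalSpace S] [T2Space S] [SecondCountableTopology S] [CompactSpace S]
      [ConnectedSpace S] [ChartedSpace (EuclideanSpace ℝ (Fin 4)) S] [IsManifold (𝓡 4) ∞ S]
      (j : S → E5) (hj : Manifold.IsSmoothEmbedding (𝓡 4) (𝓡 5) ∞ j)
      (hmodel : IsBlowUpModel T x₀ t₀ ((⇑A) '' Set.range j)) (e : P ≃ₘ⟮𝓡 4, 𝓡 4⟯ S) :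
      IsProxyResolvable T P
  /-- Invariance under diffeomorphism onto a `C^∞` manifold. -/
  | of_diffeomorph {P P' : Type} [TopologicalSpace P] [ChartedSpace (EuclideanSpace ℝ (Fin 4)) P]
      [TopologicalSpace P'] [ChartedSpace (EuclideanSpace ℝ (Fin 4)) P'] [IsManifold (𝓡 4) ∞ P']
      (h : IsProxyResolvable T P) (e : P ≃ₘ⟮𝓡 4, 𝓡 4⟯ P') : IsProxyResolvable T P'
  /-- Surgery along a separating neck: if both capped sides are resolved, so is `P`. -/
  | surgery {P : Type} [TopologicalSpace P] [T2Space P] [ChartedSpace (EuclideanSpace ℝ (Fin 4)) P]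
      [IsManifold (𝓡 4) ∞ P] {ψ : 𝕊³ × ℝ → P} (D₁ : NeckCapData 3 ψ)
      (D₂ : NeckCapData 3 (fun q : 𝕊³ × ℝ => ψ (q.1, -q.2)))
      (hdisj : Disjoint (D₁.side : Set P) D₂.side)
      (hcover : ∀ p : P, p ∉ D₁.side → p ∉ D₂.side → ∃ θ : 𝕊³, ψ (θ, 0) = p)
      (h₁ : IsProxyResolvable T D₁.Capped) (h₂ : IsProxyResolvable T D₂.Capped) :
      IsProxyResolvable T P

/-- **Hamilton's bound in CMS currency, for the track `T`**: every compact smooth blow-up model `A''(range j)` of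
`T` at a positive time has Gaussian entropy (tree `gaussianEntropy 4`, Colding–Minicozzi) strictly below that of the
bubble-sheet cylinder `S²(2) × ℝ² = shrinkingCylinder 4 2` — the hypothesis of clause (b) of the tree fact
`ChodoshMantoulidisSchulze2025_lowEntropy_sphere_four`, with `<`. -/
def ModelEntropyBound (T : Set (E6 × ℝ)) : Prop :=
  ∀ (x₀ : E6) (t₀ : ℝ), 0 < t₀ → ∀ (A : E5 →ₗᵢ[ℝ] E6),
    (∀ v : E5, ∑ i : Fin 5, (A v) (Fin.castSucc i) * x₀ (Fin.castSucc i) = 0) →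
    ∀ (S : Type) [TopologicalSpace S] [T2Space S] [SecondCountableTopology S] [CompactSpace S]
      [ConnectedSpace S] [ChartedSpace (EuclideanSpace ℝ (Fin 4)) S] [IsManifold (𝓡 4) ∞ S]
      (j : S → E5), Manifold.IsSmoothEmbedding (𝓡 4) (𝓡 5) ∞ j →
      IsBlowUpModel T x₀ t₀ ((⇑A) '' Set.range j) →
      gaussianEntropy 4 (Set.range j) < gaussianEntropy 4 (shrinkingCylinder 4 2)

/-! ## The six statements (named `Prop`s; each is the type of one registered stub) -/

/-- **Statement 1 — TAME POINTS ARE OPEN (lever (ii), "no accumulation below the bubble sheet").** For every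
presentation of `N`, every closed smooth 4-manifold `P` and every thin smooth hypersurface `κ : P ↪ N`
(`λ_cyl(range κ) < 4/e`; no separation, no topology) whose level set flow does not fatten (`HasThinTrack`), if
`(x₀, t₀)`, `t₀ > 0`, is a tame point of the track, then all points of the track in a spacetime neighbourhood of
`(x₀, t₀)` are tame. -/
def TameIsOpen : Prop :=
  ∀ (Ncar : Type) [TopologicalSpace Ncar] [ChartedSpace (EuclideanSpace ℝ (Fin 5)) Ncar] [IsManifold (𝓡 5) ∞ Ncar]
    (gN : PseudoRiemannianMetric (𝓡 5) ∞ (EuclideanSpace ℝ (Fin 5)) (TangentSpace (𝓡 5) : Ncar → Type _))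
    [gN.HasLeviCivita] (emb : Ncar → E6), IsCylinderPresentation gN emb →
  ∀ (P : Type) [TopologicalSpace P] [T2Space P] [SecondCountableTopology P] [CompactSpace P]
    [ChartedSpace (EuclideanSpace ℝ (Fin 4)) P] [IsManifold (𝓡 4) ∞ P] (κ : P → E6),
    Manifold.IsSmoothEmbedding (𝓡 4) (𝓡 6) ∞ κ → (∀ x, ∑ i : Fin 5, κ x (Fin.castSucc i) ^ 2 = 1) →
    cylEntropy (Set.range κ) < ENNReal.ofReal (4 / Real.exp 1) →
    HasThinTrack (flowTrack gN emb (emb ⁻¹' Set.range κ)) →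
  ∀ (x₀ : E6) (t₀ : ℝ), 0 < t₀ → (x₀, t₀) ∈ flowTrack gN emb (emb ⁻¹' Set.range κ) →
    IsTamePoint (flowTrack gN emb (emb ⁻¹' Set.range κ)) x₀ t₀ →
    ∃ δ : ℝ, 0 < δ ∧ ∀ (x₁ : E6) (t₁ : ℝ), (x₁, t₁) ∈ flowTrack gN emb (emb ⁻¹' Set.range κ) →
      dist x₁ x₀ < δ → |t₁ - t₀| < δ → IsTamePoint (flowTrack gN emb (emb ⁻¹' Set.range κ)) x₁ t₁

/-- **Statement 2 — GENERIC TAMENESS IN THE CYLINDER (the conclusion of the port).** Every closed connected smooth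
4-manifold `P` admitting a thin end-separating cross-section embedding `κ` into `N` admits one, `κ'`, whose level set
flow in `N` is TAME — together with a presentation `(Ncar, gN, emb)` of `N` in which the flow is run. (Closeness of
`κ'` to `κ` is true but not consumed downstream, so it is not recorded.) -/
def DensityDropPort : Prop :=
  ∀ (P : Type) [TopologicalSpace P] [T2Space P] [SecondCountableTopology P] [CompactSpace P]
    [ConnectedSpace P] [ChartedSpace (EuclideanSpace ℝ (Fin 4)) P] [IsManifold (𝓡 4) ∞ P] (κ : P → E6),
    Manifold.IsSmoothEmbedding (𝓡 4) (𝓡 6) ∞ κ → (∀ x, ∑ i : Fin 5, κ x (Fin.castSucc i) ^ 2 = 1) →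
    SeparatesEnds (Set.range κ) → cylEntropy (Set.range κ) < ENNReal.ofReal (4 / Real.exp 1) →
    ∃ (Ncar : Type) (_ : TopologicalSpace Ncar) (_ : ChartedSpace (EuclideanSpace ℝ (Fin 5)) Ncar)
      (_ : IsManifold (𝓡 5) ∞ Ncar)
      (gN : PseudoRiemannianMetric (𝓡 5) ∞ (EuclideanSpace ℝ (Fin 5)) (TangentSpace (𝓡 5) : Ncar → Type _))
      (_ : gN.HasLeviCivita) (emb : Ncar → E6),
      IsCylinderPresentation gN emb ∧
      ∃ κ' : P → E6, Manifold.IsSmoothEmbedding (𝓡 4) (𝓡 6) ∞ κ' ∧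
        (∀ x, ∑ i : Fin 5, κ' x (Fin.castSucc i) ^ 2 = 1) ∧ SeparatesEnds (Set.range κ') ∧
        cylEntropy (Set.range κ') < ENNReal.ofReal (4 / Real.exp 1) ∧
        IsTame (flowTrack gN emb (emb ⁻¹' Set.range κ'))

/-- **Statement 3 — HAMILTON'S ENTROPY BOUND FOR BLOW-UP MODELS (in CMS currency).** For every presentation, every
closed `P` and every thin smooth hypersurface `κ : P ↪ N` (`λ_cyl < 4/e`; no separation, no topology), every compact
smooth blow-up model of the level set flow of `range κ` at a positive time satisfies `ModelEntropyBound`. -/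
def HamiltonEntropyBound : Prop :=
  ∀ (Ncar : Type) [TopologicalSpace Ncar] [ChartedSpace (EuclideanSpace ℝ (Fin 5)) Ncar] [IsManifold (𝓡 5) ∞ Ncar]
    (gN : PseudoRiemannianMetric (𝓡 5) ∞ (EuclideanSpace ℝ (Fin 5)) (TangentSpace (𝓡 5) : Ncar → Type _))
    [gN.HasLeviCivita] (emb : Ncar → E6), IsCylinderPresentation gN emb →
  ∀ (P : Type) [TopologicalSpace P] [T2Space P] [SecondCountableTopology P] [CompactSpace P]
    [ChartedSpace (EuclideanSpace ℝ (Fin 4)) P] [IsManifold (𝓡 4) ∞ P] (κ : P → E6),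
    Manifold.IsSmoothEmbedding (𝓡 4) (𝓡 6) ∞ κ → (∀ x, ∑ i : Fin 5, κ x (Fin.castSucc i) ^ 2 = 1) →
    cylEntropy (Set.range κ) < ENNReal.ofReal (4 / Real.exp 1) →
    ModelEntropyBound (flowTrack gN emb (emb ⁻¹' Set.range κ))

/-- **Statement 4 — RELAXATION TO A SLICE (the immortal half).** For every presentation, every closed CONNECTED `P`
and every thin end-separating cross-section `κ : P ↪ N` whose level set flow is tame, there is `T₀ ≥ 0` such that
for every `t ≥ T₀` the time-`t` flow is the range of a smooth embedding `S⁴ ↪ Ncar`. No homotopy hypothesis: the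
conclusion is claimed for EVERY closed connected `P` (it cannot smuggle the crux); it is false for `P = S⁴ ⊔ S⁴`
(two slices, the disprover's witness `CylinderSlice.twoSlices`), whence `[ConnectedSpace P]`. -/
def RelaxationToSlice : Prop :=
  ∀ (Ncar : Type) [TopologicalSpace Ncar] [ChartedSpace (EuclideanSpace ℝ (Fin 5)) Ncar] [IsManifold (𝓡 5) ∞ Ncar]
    (gN : PseudoRiemannianMetric (𝓡 5) ∞ (EuclideanSpace ℝ (Fin 5)) (TangentSpace (𝓡 5) : Ncar → Type _))
    [gN.HasLeviCivita] (emb : Ncar → E6), IsCylinderPresentation gN emb →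
  ∀ (P : Type) [TopologicalSpace P] [T2Space P] [SecondCountableTopology P] [CompactSpace P]
    [ConnectedSpace P] [ChartedSpace (EuclideanSpace ℝ (Fin 4)) P] [IsManifold (𝓡 4) ∞ P] (κ : P → E6),
    Manifold.IsSmoothEmbedding (𝓡 4) (𝓡 6) ∞ κ → (∀ x, ∑ i : Fin 5, κ x (Fin.castSucc i) ^ 2 = 1) →
    SeparatesEnds (Set.range κ) → cylEntropy (Set.range κ) < ENNReal.ofReal (4 / Real.exp 1) →
    IsTame (flowTrack gN emb (emb ⁻¹' Set.range κ)) →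
    ∃ T₀ : ℝ, 0 ≤ T₀ ∧ ∀ t : ℝ, T₀ ≤ t →
      ∃ φ : 𝕊⁴ → Ncar, Manifold.IsSmoothEmbedding (𝓡 4) (𝓡 5) ∞ φ ∧
        Set.range φ = levelSetFlow gN (emb ⁻¹' Set.range κ) t

/-- **Statement 5 — STRUCTURE OF TAME THIN FLOWS (the finite half + proxy capture).** For every presentation, every
closed simply connected `P`, every thin smooth hypersurface `κ : P ↪ N` with TAME level set flow which at some time
`T₀ ≥ 0` is a smoothly embedded `S⁴`, the manifold `P` is `IsProxyResolvable` for the track: resolved by finitely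
many separating neck surgeries into pieces `≅ S⁴` and pieces `≅ S`, `S` the domain of a compact smooth blow-up model
of the track at a positive time. -/
def TameSurgeryStructure : Prop :=
  ∀ (Ncar : Type) [TopologicalSpace Ncar] [ChartedSpace (EuclideanSpace ℝ (Fin 5)) Ncar] [IsManifold (𝓡 5) ∞ Ncar]
    (gN : PseudoRiemannianMetric (𝓡 5) ∞ (EuclideanSpace ℝ (Fin 5)) (TangentSpace (𝓡 5) : Ncar → Type _))
    [gN.HasLeviCivita] (emb : Ncar → E6), IsCylinderPresentation gN emb →
  ∀ (P : Type) [TopologicalSpace P] [T2Space P] [SecondCountableTopology P] [CompactSpace P]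
    [ChartedSpace (EuclideanSpace ℝ (Fin 4)) P] [IsManifold (𝓡 4) ∞ P] [SimplyConnectedSpace P] (κ : P → E6),
    Manifold.IsSmoothEmbedding (𝓡 4) (𝓡 6) ∞ κ → (∀ x, ∑ i : Fin 5, κ x (Fin.castSucc i) ^ 2 = 1) →
    cylEntropy (Set.range κ) < ENNReal.ofReal (4 / Real.exp 1) →
    IsTame (flowTrack gN emb (emb ⁻¹' Set.range κ)) →
    ∀ T₀ : ℝ, 0 ≤ T₀ → ∀ φ : 𝕊⁴ → Ncar, Manifold.IsSmoothEmbedding (𝓡 4) (𝓡 5) ∞ φ →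
      Set.range φ = levelSetFlow gN (emb ⁻¹' Set.range κ) T₀ →
      IsProxyResolvable (flowTrack gN emb (emb ⁻¹' Set.range κ)) P

/-! ## The six registered stubs (`theorem Holds.stub_<name> : <statement> := by sorry`; `ledger skeleton check`
registers the short name `stub_<name>` with the statement name as its signature) -/

/-- **Stub 1 — `TameIsOpen` (lever (ii)).** Why plausibly true (all printed, all valid in a Riemannian ambient; the
flow in `N` is the unit-regular integral Brakke flow of elliptic regularisation, whose support is the level set flow
when the latter is thin): a HYPERPLANE model means Gaussian density `1`, an open condition (White's local regularity
theorem, Ann. Math. 161 (2005) 1487, written with Hamilton's kernel density `F̂_{x,r²}` of `N`, which tends to the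
Euclidean density ratio as `r → 0`; unit-regularity is two-sided in time); a ROUND model means a convex component
vanishing smoothly (Huisken 1986, convex hypersurfaces of Riemannian manifolds), after which the rest of the flow is
at positive distance (monotonicity: anything reaching `x₀` at time `t₀` is visible in the blow-up) and stays away for a
short time (avoidance with small geodesic spheres); a NECK model has a mean-convex canonical neighbourhood
(Choi–Haslhofer–Hershkovits–White, Invent. Math. 229 (2022), arXiv:1910.00639 Thm 1.17 with footnote p. 9 "also
holds … in arbitrary ambient manifolds", Cor 1.18; Bernstein–Wang; Choi–Haslhofer–Hershkovits), inside which every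
tangent flow is a multiplicity-one generalised cylinder `Sᵏ × ℝ⁴⁻ᵏ` (White 2003), and entropy `< 4/e` leaves
`k ∈ {3, 4}` (bubble sheet `S² × ℝ²` sits AT `4/e`, `S¹ × ℝ³` above — Stone); a COMPACT SMOOTH model captures a whole
component converging smoothly with multiplicity one (entropy `< 2`), so nearby track points are regular until the
isolated death, and the other sheets are away as in the round case (the model is connected: two compact components
would cost Gaussian density `≥ 2λ(S⁴) > 4/e`, Colding–Ilmanen–Minicozzi–White). This is exactly the dichotomy CMS II
(arXiv:2309.03856 §1.2, p. 4) call "only known" at `Sⁿ(√2n)` and `Sⁿ⁻¹×ℝ` limits; strictly below `4/e` it covers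
every generic limit. Why it might fail: only through the set-level reading of blow-up models (a Hausdorff limit of
supports that is not the support of a tangent flow) — excluded for unit-regular flows by clearing-out; `HasThinTrack`
is assumed precisely so that support = level set flow. Size M–L.
[arXiv:1910.00639 Thm 1.17, Cor 1.18; arXiv:2309.03856 §1.2; doi:10.4007/annals.2005.161.1487; Huisken1986;
doi:10.1090/S0894-0347-02-00406-X (White 2003)] -/
theorem Holds.stub_tameIsOpen : TameIsOpen := by
  sorry

/-- **Stub 2 — THE PORT: `TameIsOpen → DensityDropPort` (HARDEST; the open heart of the line).** Granted lever (ii)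
(so that on thin tracks the non-tame points form a CLOSED subset `𝔑` of spacetime), every closed connected `P` with a
thin end-separating cross-section `κ` has one, `κ'`, whose level set flow in `N` is tame, in some presentation of `N`
(construct `ℝ⁵ ∖ {0}` with the induced metric along `y ↦ (y/‖y‖, log ‖y‖)`, tree `inducedMetric`/`hasLeviCivita`).
Mechanism = Chodosh–Mantoulidis–Schulze, *MCF with generic low-entropy initial data II*, Duke 2025 = arXiv:2309.03856,
Thm 1.13 for `n = 4`, `Λ = 4/e < 2` (read pp. 3–6: hypotheses `(◇_{n,Λ})` vacuous for `n ≤ 6`, Rem 1.16, and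
`(♡_{n,Λ})` vacuous for `n ≤ 4`, Rem 1.17(a); Cor 1.19 is the `n = 4` case), proved there by §2 (rescaled flows,
smoothly crossing = one-sided approximating flows `𝔉(M)` of Def 1.12, parabolic covering), §3 (regularity and
eigenvalue estimates for low-entropy `F`-stationary varifolds — this is where compact SINGULAR models, cones over
minimal `Σ³ ⊂ S⁴` with `|Σ³|/|S³| < 4/e`, are handled, triage r1-2), §4 (local estimates for nearly ancient one-sided
flows near nearly self-similar flows), §5 (the density drop: `D_𝔑(s)` is upper semicontinuous in the leaf parameter of
a normal foliation `{M^s}` — uses only `𝔑` closed + usc of density —, drops by a definite `η₀` across every non-generic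
point, hence `sing ∩ 𝔑 = ∅` for an open dense / full-measure set of leaves), transplanted from `ℝ⁵` to `N`: Hamilton's
kernel density `Θ^N(X, r) = F̂_{x,r²}(M_{t-r²})` is monotone in `r` along Brakke flows in `N` (Hamilton, CAG 1 (1993)
127–137, from the matrix Harnack inequality ibid. 113–126 — for the PRODUCT backward kernel of `S⁴ × ℝ` the Harnack
matrix is `(Hess log H_{S⁴} + g/2τ) ⊕ 0`, the `S⁴` block being Hamilton's compact case `sec ≥ 0`, `∇Ric = 0`;
numerically coercive, `HarnackNumericsK3.md` + three triage rechecks), upper semicontinuous, Euclidean as `r → 0` and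
`≤ λ_cyl(M₀)` — the four properties §5 uses of Huisken's `Θ`; the one-sided/Łojasiewicz arguments of §§3–4 are
blow-up-local, hence ambient-free; §6 (non-generic points accumulating at BUBBLE-SHEET points, the spine/eigenvalue
coupling of their §1.2) is never entered because below `4/e` there are no bubble-sheet points and `𝔑` is closed by
stub 1 (fattening leaves are countably many and discarded first, so stub 1 is only invoked on thin tracks); leaves
`C¹`-close to `κ` are still end-separating cross-sections with `λ_cyl < 4/e` (small scales: `C¹`-continuity of Gaussian
ratios; large scales: area ratio, tree `measure_ratio_le_cylEntropy`). IMMORTALITY is the one global difference: the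
flow in `N` never goes extinct, so the covering argument needs the non-tame set of the whole leaf family inside a
COMPACT spacetime region — a relaxation time uniform over the compact family of leaves (the entropy form
`λ_cyl(M_t) → 1` of stub 4's mechanism + White's gap: no singular point once `λ_cyl(M_T) < 1 + ε₄`; uniformity by
upper semicontinuity under Brakke-flow convergence). Why it might fail: Prop 5.2's density drop and the generic-leaf
selection are written with the global Euclidean structure (translations, exact Gaussian, global graphs over shrinkers
at all scales), in `N` the foliation is only local and Hamilton's density replaces Huisken's — every step must be
re-verified; the uniform relaxation time is new. Size XL / open.
[arXiv:2309.03856 Thm 1.13, Rem 1.16–1.17, Cor 1.19, §§2–5; arXiv:2102.11978; arXiv:2003.14344;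
doi:10.4310/cag.1993.v1.n1.a7; doi:10.4310/cag.1993.v1.n1.a6] -/
theorem Holds.stub_densityDropPort : TameIsOpen → DensityDropPort := by
  sorry

/-- **Stub 3 — `HamiltonEntropyBound`.** Mechanism: Hamilton's monotonicity of `t ↦ F̂_{x₀, t₀-t}(M_t)` along the
(unit-regular Brakke) flow in `N` (Hamilton 1993, via the factorwise Harnack matrix of the product kernel, as in stub 2)
gives the kernel density `Θ^N(x₀,t₀) ≤ sup_{p,τ} F̂_{p,τ}(M₀) = λ_cyl(range κ)`; the small-scale asymptotics of the
typed Gegenbauer kernel (`𝔥(τ, cos θ) ~ vol S⁴ · (4πτ)⁻² e^{-θ²/4τ}`, slices calibrated, so the `μH` normalisations of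
`cylDensity` and of `gaussianEntropy 4` cancel) identify `Θ^N` with the hyperplane-normalised Euclidean Gaussian
density of the tangent flow, i.e. with `m · F_{0,1}(Σ)`, `m ≥ 1`, for the model `Σ = A(range j)` (the set-level model
is the support of the tangent flow: clearing-out); for a closed smooth embedded shrinker `F_{0,1}(Σ) = λ(Σ)`
(Colding–Minicozzi, Ann. Math. 175 (2012), §7); `λ` is isometry-invariant (tree `ColdingMinicozziEntropyInvariance`), so
`gaussianEntropy 4 (range j) = λ(Σ) ≤ λ_cyl(range κ) < 4/e = λ(S²(2) × ℝ²) = gaussianEntropy 4 (shrinkingCylinder 4 2)`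
(Stone 1994; tree named fact `Stone1994_cylinderEntropy`, discharged in `ColdingMinicozziEntropyValuesProofs`). The
sharper `λ(Σ) ≤ λ_cyl(range κ)` is what is proved; the CMS-currency corollary is what the glue consumes. Why it might
fail: the identification of the set-level model with the support of a tangent flow needs unit regularity of the level
set flow of thin smooth data (entropy `< 2`); a fat track has no compact hypersurface model, so non-fattening is not
needed here. Size L.
[doi:10.4310/cag.1993.v1.n1.a7; doi:10.4310/cag.1993.v1.n1.a6; doi:10.4007/annals.2012.175.2.7 §7; Stone1994] -/
theorem Holds.stub_hamiltonEntropyBound : HamiltonEntropyBound := by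
  sorry

/-- **Stub 4 — `RelaxationToSlice` (immortal half; shared with the lines ground-state-relaxation / killing-flux, whose
first lemmas A1/B1 are already proved: `TRIAGE-r1-1-FirstLemmas.lean`, `TriageR1K2Lemmas.lean`).** Mechanism, in the
order that avoids any unit-scale `ε`-regularity: (1) separation is preserved along the level set flow (intermediate
value argument as in tree `CylinderSlice.separatesEnds_of_slice_subset`; White, CAG 3 (1995) Thm 1 is the printed
backstop), so the area floor (tree `hausdorffMeasure_sphere_le_of_separatesEnds`) keeps the root component alive
and the total mass `A(t) ↓ A_∞ ≥ vol S⁴`; the flow is trapped between two static slices (avoidance); (2) subsequential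
limits of time-translates are stationary integral varifolds in `N` with compact support and `λ_cyl < 2`, hence ONE
slice with multiplicity one (a compactly supported stationary varifold contains its top and bottom slices — strong
maximum principle against the totally geodesic slice foliation — and two slices cost `λ_cyl ≥ 2` by A1 = tree
`measure_ratio_le_cylEntropy`; alternatively first variation along `φ(s)∂_s`); (3) backward Hamilton monotonicity
`F̂_{p,τ}(M_t) ≤ F̂_{p,τ+1}(M_{t-1})` moves every scale into `[1, ∞)`, where the kernels are equicontinuous on the slab
(tree `one_sub_tail_le_zonal` for `τ → ∞`, the Gaussian factor for far `p`), so `limsup_t λ_cyl(M_t) ≤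
sup_c λ_cyl(slice_c) ≤ 1` (the "`≤ 1`" half of route item SliceCalibration, Funk–Hecke) and `≥ 1` by the floor:
`λ_cyl(M_t) → 1`; (4) ETERNAL REGULARITY: pick `T` with `λ_cyl(M_T) < 1 + ε₄`, White's gap (every singular point of a
unit-regular flow has Gaussian density `≥ 1 + ε₄`; Brakke 1978 / White 2005); by Hamilton's monotonicity from time `T`
every later point has `Θ^N ≤ λ_cyl(M_T)`, so there is NO singular point after `T` — in particular no compact component
can go extinct after `T` (an extinction point is singular), every component alive at `T` is immortal, smooth, and by
(2) converges to a multiplicity-one slice, hence is end-separating; two separating components would cost `λ_cyl ≥ 2`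
(B1, `uniqueSeparatingSheet`), so `M_t` is ONE smooth connected separating hypersurface for `t > T` (all debris died
before `T`); (5) smooth convergence to the slice (Allard / White regularity from `λ_cyl → 1`; Łojasiewicz–Simon at the
integrable slice family, or simply: once a `C¹`-small normal graph over a slice, it stays graphical — Borisenko–Miquel
2012 — and is an embedded `S⁴`). Tameness is used only to exclude fattening (interior track points are not tame), so
that the level set flow is the support of the unit-density Brakke flow. (Context, not used: the sharp gap "closed or
partially collapsed non-flat shrinkers have `λ ≥ λ(S⁴)`", Bernstein–Wang Invent. 2016 Thm 1.1–1.2 = arXiv:1406.2966,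
Zhu JDG 2020 = arXiv:1607.07760, would make `ε₄ = λ(S⁴) - 1 = 32/(3e²) - 1` explicit only modulo the open CIMW
conjecture for general non-compact shrinkers.) Why it might fail: step (2)'s maximum principle and step (5)'s
graphical convergence must be run for varifold limits of a Brakke flow in `N` (Solomon–White / White 2010 strong
maximum principle for stationary varifolds in Riemannian manifolds); the "`≤ 1`" half of SliceCalibration (item 7634)
is an input. Size L/XL.
[doi:10.4310/cag.1993.v1.n1.a7; doi:10.4007/annals.2005.161.1487; doi:10.4310/cag.1995.v3.n2.a5 Thm 1;
doi:10.1090/s0002-9947-2012-05425-0; arXiv:0906.0189 (White, maximum principle); Simon1983] -/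
theorem Holds.stub_relaxationToSlice : RelaxationToSlice := by
  sorry

/-- **Stub 5 — `TameSurgeryStructure` (Daniels–Holgate in `N`, topological shadow, + proxy capture).** Mechanism: on
`[0, T₀]` the singular points of the tame flow are neck points, round points and compact-smooth-model points. Neck
points have mean-convex canonical neighbourhoods, a canonical-neighbourhood structure and uniqueness of continuation
(CHHW arXiv:1910.00639 Thm 1.17 / Cor 1.18 / Thm 1.19, all "in arbitrary ambient manifolds", footnote p. 9); across a
neck singular time the topology of the time slices changes by surgeries along finitely many (compactness of the
canonical-neighbourhood cover of the singular set in `[0, T₀]`) necks `S³ × ℝ ↪ P_t` — Daniels-Holgate 2022's smooth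
flow with surgery approximating the weak flow, whose only global Euclidean ingredient (Huisken's density) is
Hamilton's here — and every neck SEPARATES because all pieces stay simply connected (`π₁(P) = 1`, van Kampen across
`S³`; tree `exists_neckCapData_of_simplyConnected`, Hirsch Thm 4.6), which is the `surgery` constructor with the
post-surgery components as capped sides; PROXY CAPTURE: at a compact-smooth-model point `(x₀, t₀)` the rescaled flow
converges smoothly with multiplicity one (entropy `< 2`, Brakke–White regularity) to the compact `Σ = A(j(S))`, so for
`t₁ < t₀` close to `t₀` a whole connected component of the time-`t₁` slice is a normal graph over
`exp_{x₀}(√(t₀-t₁)·Σ)`, hence `≅ S`, and it vanishes at `t₀` (leaf `model`); a component disappearing through neck /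
round points only (degenerate neck-pinch of a whole 2-convex tube) is `≅ S⁴` (leaf `sphere`, CHHW canonical
neighbourhoods / Brendle–Huisken-type classification of 2-convex pieces); at time `T₀` the single surviving piece is
the given embedded `S⁴` (leaf `sphere`; for `T₀ = 0`, `κ⁻¹ ∘ emb ∘ φ` is already a diffeomorphism `S⁴ ≅ P`). Why it
might fail: upgrading White-1995-level (`H₀`/homotopy) topology change to DIFFEOMORPHISM bookkeeping across degenerate
or accumulating neck pinches is a local re-do of Daniels–Holgate in `N` (triage r1-2/3 on separating-sheet-genealogy);
"finitely many surgery necks on `[0, T₀]`" needs the canonical-neighbourhood compactness argument with Hamilton's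
density. Size L/XL.
[DanielsHolgate2022 = doi:10.1016/j.aim.2022.108715; arXiv:1910.00639 Thm 1.17–1.19; doi:10.4310/cag.1995.v3.n2.a5 Thm 1;
Hamilton1997 §1.1; doi:10.1007/s00222-008-0148-4 (Brendle–Huisken-type 2-convex surgery: Huisken–Sinestrari 2009)] -/
theorem Holds.stub_tameSurgeryStructure : TameSurgeryStructure := by
  sorry

/-- **Stub 6 — the Euclidean black box BY NAME: the tree named fact
`Literature.Geometry.Riemannian.ChodoshMantoulidisSchulze2025_lowEntropy_sphere_four`** (Chodosh–Mantoulidis–Schulze,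
Duke 2025, Cor 1.5 (a),(b) = Cor 1.22, `n = 4`, unconditional by Rem 1.16/1.17; `LowEntropyHypersurfacesFour.lean`,
statement only, D-0014; read on the page by grounder g20-58, the three triagers and this planner, pp. 3–6). The glue
consumes clause (b): a closed connected SIMPLY CONNECTED smooth 4-manifold embedded in `ℝ⁵` with
`gaussianEntropy 4 ≤ gaussianEntropy 4 (shrinkingCylinder 4 2)` is `≅ S⁴`. CITATION STUB: it is the printed theorem
itself, referenced by name (no restatement); it is discharged only by a formal proof of CMS Cor 1.5 (Daniels–Holgate
surgery inside) or by the route conditioning the crux on the fact, so the honest terminal state of this line is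
"closed modulo ⟨ChodoshMantoulidisSchulze2025_lowEntropy_sphere_four⟩" (D-0027 §2.1). Do not staff. Size: citation.
[arXiv:2309.03856 Cor 1.5, Cor 1.22; DanielsHolgate2022] -/
theorem Holds.stub_cmsLowEntropySphereFour : ChodoshMantoulidisSchulze2025_lowEntropy_sphere_four := by
  sorry

/-! ### By-name handles of the six statements (the skeleton audit admits a hypothesis of `CylinderRungTwo_of` only if
its head constant is a registered stub BY NAME; the `@[stub]` attribute is gate-reserved) -/

/-- Statement of registered stub 1 (`Holds.stub_tameIsOpen`), by name. -/
def stub_tameIsOpen : Prop := TameIsOpen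

/-- Statement of registered stub 2 (`Holds.stub_densityDropPort`), by name. -/
def stub_densityDropPort : Prop := TameIsOpen → DensityDropPort

/-- Statement of registered stub 3 (`Holds.stub_hamiltonEntropyBound`), by name. -/
def stub_hamiltonEntropyBound : Prop := HamiltonEntropyBound

/-- Statement of registered stub 4 (`Holds.stub_relaxationToSlice`), by name. -/
def stub_relaxationToSlice : Prop := RelaxationToSlice

/-- Statement of registered stub 5 (`Holds.stub_tameSurgeryStructure`), by name. -/
def stub_tameSurgeryStructure : Prop := TameSurgeryStructure

/-- Statement of registered stub 6 (`Holds.stub_cmsLowEntropySphereFour`), by name: the tree fact itself. -/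
def stub_cmsLowEntropySphereFour : Prop := ChodoshMantoulidisSchulze2025_lowEntropy_sphere_four

/-! ## Glue (sorry-free) -/

/-- **The topological glue of the line** (induction over the surgery tree, mirroring the tree's
`IsNeckSurgeryResolvable.isConnectedSumOfSpheres`): if every compact smooth blow-up model of `T` has entropy below the
bubble sheet (Hamilton, stub 3 for this track) and CMS Cor 1.5 (b) holds (stub 6, the tree fact by name), then a SIMPLY
CONNECTED `IsProxyResolvable T P` is `IsNeckSurgeryResolvable` in Hamilton's sense: model leaves are simply connected
(simple connectivity descends to capped sides of separating necks, `IsConnectedSum.simplyConnectedSpace_left/right`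
after `NeckCapData.isConnectedSum_capped`, and is a diffeomorphism invariant), hence spheres. -/
theorem IsProxyResolvable.neckSurgeryResolvable {T : Set (E6 × ℝ)} (hB : ModelEntropyBound T)
    (hCMS : ChodoshMantoulidisSchulze2025_lowEntropy_sphere_four) {P : Type} [TopologicalSpace P]
    [ChartedSpace (EuclideanSpace ℝ (Fin 4)) P] (h : IsProxyResolvable T P) (hsc : SimplyConnectedSpace P) :
    IsNeckSurgeryResolvable P := by
  induction h with
  | sphere e => exact .of_nonempty_diffeomorph_sphere ⟨e⟩
  | model x₀ t₀ ht₀ A hA S j hj hmodel e =>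
    have hscS : SimplyConnectedSpace S := (e.toHomeomorph.toHomotopyEquiv.simplyConnectedSpace_iff).1 hsc
    obtain ⟨eS⟩ := hCMS.2 S hscS j hj (hB x₀ t₀ ht₀ A hA S j hj hmodel).le
    exact .of_nonempty_diffeomorph_sphere ⟨e.trans eS⟩
  | of_diffeomorph h e ih =>
    exact (ih ((e.toHomeomorph.toHomotopyEquiv.simplyConnectedSpace_iff).2 hsc)).of_diffeomorph e
  | surgery D₁ D₂ hdisj hcover h₁ h₂ ih₁ ih₂ =>
    haveI := hsc
    have hcs : IsConnectedSum (𝓡 4) (𝓡 4) (𝓡 4) D₁.Capped D₂.Capped _ :=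
      D₁.isConnectedSum_capped D₂ (fun _ _ => rfl) hdisj hcover
    have h2 : 1 < Module.finrank ℝ (EuclideanSpace ℝ (Fin 4)) := by
      rw [finrank_euclideanSpace_fin]
      norm_num
    exact .surgery D₁ D₂ hdisj hcover (ih₁ (hcs.simplyConnectedSpace_left h2))
      (ih₂ (hcs.simplyConnectedSpace_right h2))

/-- **The composition (D-0027 §3.2(3) shape).** The six registered stubs, BY NAME, imply the crux
`CylinderEntropy.CylinderRungTwo` BY NAME; the cone of this theorem is sorry-free. `M ≃ₕ S⁴` is used exactly three
ways: compactness (tree `compactSpace_of_homotopyEquiv_sphere_four_holds`), connectedness (stubs 2, 4; tree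
`pathConnectedSpace_of_homotopyEquiv`) and simple connectivity (stub 5, the glue, the CMS leaf, the final tree theorem
`IsNeckSurgeryResolvable.nonempty_diffeomorph_sphere`). The crux's inline separation predicate and entropy ARE
`SeparatesEnds (range ι)` and `cylEntropy (range ι)` by `rfl`. -/
theorem CylinderRungTwo_of (h₁ : stub_tameIsOpen) (h₂ : stub_densityDropPort) (h₃ : stub_hamiltonEntropyBound)
    (h₄ : stub_relaxationToSlice) (h₅ : stub_tameSurgeryStructure) (h₆ : stub_cmsLowEntropySphereFour) :
    Summit.SmoothPoincare4.SmoothPoincare4.Theses.CylinderEntropy.CylinderRungTwo := by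
  intro M _ _ _ _ _ e ι hι hN hsep hthin
  haveI : CompactSpace M :=
    Literature.Topology.FourManifolds.compactSpace_of_homotopyEquiv_sphere_four_holds M e
  haveI : SimplyConnectedSpace M :=
    haveI := Literature.AlgebraicTopology.FundamentalGroup.simplyConnectedSpace_euclideanSphere 4 (by norm_num)
    e.simplyConnectedSpace
  haveI : PathConnectedSpace 𝕊⁴ := Literature.Topology.FourManifolds.pathConnectedSpace_sphere_four
  haveI : PathConnectedSpace M := Literature.Topology.FourManifolds.pathConnectedSpace_of_homotopyEquiv e
  have hsep' : SeparatesEnds (Set.range ι) := hsep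
  have hthin' : cylEntropy (Set.range ι) < ENNReal.ofReal (4 / Real.exp 1) := hthin
  -- Stubs 1 + 2: a presentation of `N` and a thin separating cross-section `κ` of `M` with TAME level set flow
  have hport : DensityDropPort := h₂ h₁
  obtain ⟨Ncar, _, _, _, gN, _, emb, hpres, κ, hκ, hκN, hκsep, hκthin, htame⟩ :=
    hport M ι hι hN hsep' hthin'
  -- Stub 4: the flow is eventually a smoothly embedded `S⁴`
  have hrelax : RelaxationToSlice := h₄
  obtain ⟨T₀, hT₀, hslices⟩ := hrelax Ncar gN emb hpres M κ hκ hκN hκsep hκthin htame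
  obtain ⟨φ, hφ, hφr⟩ := hslices T₀ le_rfl
  -- Stub 5: `M` is resolved into spheres and compact smooth blow-up models of the track
  have hstruct : TameSurgeryStructure := h₅
  have hres : IsProxyResolvable (flowTrack gN emb (emb ⁻¹' Set.range κ)) M :=
    hstruct Ncar gN emb hpres M κ hκ hκN hκthin htame T₀ hT₀ φ hφ hφr
  -- Stub 3: Hamilton's bound for this track; stub 6: CMS on the model leaves; glue; tree
  have hham : HamiltonEntropyBound := h₃
  have hB : ModelEntropyBound (flowTrack gN emb (emb ⁻¹' Set.range κ)) :=
    hham Ncar gN emb hpres M κ hκ hκN hκthin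
  have hCMS : ChodoshMantoulidisSchulze2025_lowEntropy_sphere_four := h₆
  exact (hres.neckSurgeryResolvable hB hCMS inferInstance).nonempty_diffeomorph_sphere inferInstance

/-- The skeleton as the crux proof modulo the six registered stubs (D-0027 §3.3), kept an `example` so that
`CylinderRungTwo_of` stays the unique theorem concluding the crux; the lead turns it into
`theorem CylinderRungTwo_proof` (proposed `--workitem stmt-SmoothPoincare4-7631`) when the last stub lands. -/
example : Summit.SmoothPoincare4.SmoothPoincare4.Theses.CylinderEntropy.CylinderRungTwo :=
  CylinderRungTwo_of Holds.stub_tameIsOpen Holds.stub_densityDropPort Holds.stub_hamiltonEntropyBound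
    Holds.stub_relaxationToSlice Holds.stub_tameSurgeryStructure Holds.stub_cmsLowEntropySphereFour

end Summit.SmoothPoincare4.SmoothPoincare4.Cruxes.CylinderRungTwo.ProxyModelsBelowBubbleSheet

end
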